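import Summits.Ventures.PercRepro.C025ProfileHallOneShadow
import Summits.Ventures.PercRepro.C025ProfileGirthTable

/-!
# THE HALL FORM OF C-025 ITSELF (`ShadowHall`) IN THE GIRTH REGIMES (night-3 g19)

g7's `shadowHall_one` assembled night-2's shadow form `ShadowHall M p 1 (phiK p 1)` from the Hall forms of the rows
`(1, u)`; the same assembly is pointwise in `M` for every `q`:
* `shadowHallLevel_of_hallIneq` — the row's Hall form `(H⁺_{q,u})` gives the level-wise shadow form
  `ShadowHallLevel M p q u (C(p+q,u)/C(p+q,p))` (on the bottom sets every price is that constant);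
* **`shadowHall_of_hallIneq_rows`** `(p q) (h : ∀ u, q < u → u < p → Profile.HallIneq M q u) : Shadow.ShadowHall M p q (phiK p q)`
  — the shadow of a family of bottom sets is the disjoint union of its level shadows, and the constants sum to `Φ(p, q)`;
* **`shadowHall_of_girth`** `(p q) (hg : ∀ T ⊆ M.E, T.encard + 2 ≤ p → M.Indep T) : Shadow.ShadowHall M p q (phiK p q)`
  and **`shadowHall_of_girth_pred`** `(hpq : q + 4 ≤ p) (hg : ∀ T ⊆ M.E, T.encard + 3 ≤ p → M.Indep T)` — the HALL FORM of C-025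
  at `(p, q)` on every finite matroid of girth `≥ p − 1` (every `q`), resp. girth `≥ p − 2` (`p ≥ q + 4`); with
  `hall_of_girth` / `hall_of_girth_pred` (the per-flat Hall condition, C-029) and `rls_of_shadowHall_of_girth`-type
  consequences already in the tree (`rls_of_girth_every`, `rls_of_girth_pred_every`).
No `def`, no `instance`, no notation.  Axioms: standard.
-/

open scoped Matroid

namespace PercRepro

open Set Finset ThmH Staged

namespace GirthRows

variable {α : Type} [DecidableEq α] {M : Matroid α} [M.Finite]

/-- The Hall form of the row `(q, u)` gives the level-wise shadow form of C-025 at `(p, q)` on the level `u`, `q < u < p`. -/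
theorem shadowHallLevel_of_hallIneq (p q u : ℕ) (hup : u < p) (h : Profile.HallIneq M q u) :
    Shadow.ShadowHallLevel M p q u (((p + q).choose u : ℚ) / ((p + q).choose p : ℚ)) := by
  intro 𝒜 h𝒜
  have hsub : 𝒜 ⊆ Profile.Rq M q := h𝒜.trans (Profile.Uq_subset_Rq p q)
  have h1 := h 𝒜 hsub
  have h2 : ∑ B ∈ 𝒜, Profile.price M q u B =
      (𝒜.card : ℚ) * (((p + q).choose u : ℚ) / ((p + q).choose p : ℚ)) := by
    rw [Finset.sum_congr rfl (fun B hB => Profile.price_of_mem_Uq hup.le (h𝒜 hB)), Finset.sum_const,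
      nsmul_eq_mul, Nat.choose_symm_add]
  rw [mul_comm, ← h2]
  exact h1

/-- **The shadow form of C-025 at `(p, q)` from the Hall forms of its rows** (pointwise in `M`): if `(H⁺_{q,u})` holds
for every `q < u < p`, then `Φ(p,q) · #𝒜 ≤ #shadow(𝒜)` for every family `𝒜` of bottom sets of `(p, q)`. -/
theorem shadowHall_of_hallIneq_rows (p q : ℕ) (h : ∀ u, q < u → u < p → Profile.HallIneq M q u) :
    Shadow.ShadowHall M p q (phiK p q) := by
  intro 𝒜 h𝒜
  have hsum : ((Shadow.shadow M p q 𝒜).card : ℚ) =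
      ∑ u ∈ Finset.Ioo q p, ((Shadow.shadowLevel M u 𝒜).card : ℚ) := by
    exact_mod_cast card_shadow_eq_sum_shadowLevel (M := M) p q 𝒜
  rw [hsum, Profile.phiK_eq_sum_levels, Finset.sum_mul]
  apply Finset.sum_le_sum
  intro u hu
  rw [Finset.mem_Ioo] at hu
  have h' := shadowHallLevel_of_hallIneq p q u hu.2 (h u hu.1 hu.2) 𝒜 h𝒜
  rw [Nat.choose_symm_add] at h'
  exact h'

/-- **THE HALL FORM OF C-025 AT `(p, q)` ON EVERY MATROID OF GIRTH `≥ p − 1`** (every set of at most `p − 2` points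
independent), every `p` and `q` (for `p ≤ q + 1` there are no middle levels). -/
theorem shadowHall_of_girth (p q : ℕ) (hg : ∀ T ⊆ M.E, T.encard + 2 ≤ p → M.Indep T) :
    Shadow.ShadowHall M p q (phiK p q) := by
  apply shadowHall_of_hallIneq_rows p q
  intro u hqu hup
  apply hallIneq_of_girth_table q u hqu
  intro T hT hTu
  apply hg T hT
  have h1 : T.encard + 1 + 1 ≤ (u : ℕ∞) + 1 := by gcongr
  refine (by rw [add_assoc]; norm_num : T.encard + 2 ≤ T.encard + 1 + 1).trans (h1.trans ?_)
  have h2 : ((u + 1 : ℕ) : ℕ∞) ≤ (p : ℕ∞) := by exact_mod_cast hup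
  simpa using h2

/-- **THE HALL FORM OF C-025 AT `(p, q)` ON EVERY MATROID OF GIRTH `≥ p − 2`** (every set of at most `p − 3` points
independent), `p ≥ q + 4`. -/
theorem shadowHall_of_girth_pred (p q : ℕ) (hpq : q + 4 ≤ p) (hg : ∀ T ⊆ M.E, T.encard + 3 ≤ p → M.Indep T) :
    Shadow.ShadowHall M p q (phiK p q) := by
  apply shadowHall_of_hallIneq_rows p q
  intro u hqu hup
  rcases Nat.lt_or_ge (u + 1) p with hlt | hge
  · -- `u ≤ p − 2`: girth `≥ u`
    apply hallIneq_of_girth_table q u hqu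
    intro T hT hTu
    apply hg T hT
    have h1 : T.encard + 1 + 2 ≤ (u : ℕ∞) + 2 := by gcongr
    refine (by rw [add_assoc]; norm_num : T.encard + 3 ≤ T.encard + 1 + 2).trans (h1.trans ?_)
    have h2 : ((u + 2 : ℕ) : ℕ∞) ≤ (p : ℕ∞) := by exact_mod_cast (by omega : u + 2 ≤ p)
    simpa using h2
  · -- `u = p − 1`: girth `≥ u − 1`
    apply hallIneq_of_girth_pred_table q u (by omega)
    intro T hT hTu
    apply hg T hT
    have h1 : T.encard + 2 + 1 ≤ (u : ℕ∞) + 1 := by gcongr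
    refine (by rw [add_assoc]; norm_num : T.encard + 3 ≤ T.encard + 2 + 1).trans (h1.trans ?_)
    have h2 : ((u + 1 : ℕ) : ℕ∞) ≤ (p : ℕ∞) := by exact_mod_cast hup
    simpa using h2

/-- The per-flat Hall condition (C-029) at `(p, q)` at girth `≥ p − 1`. -/
theorem hall_of_girth (p q : ℕ) (hg : ∀ T ⊆ M.E, T.encard + 2 ≤ p → M.Indep T) :
    PerFlat.Hall M p q (phiK p q) :=
  Shadow.hall_of_shadowHall (shadowHall_of_girth p q hg)

/-- The per-flat Hall condition (C-029) at `(p, q)` at girth `≥ p − 2`, `p ≥ q + 4`. -/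
theorem hall_of_girth_pred (p q : ℕ) (hpq : q + 4 ≤ p) (hg : ∀ T ⊆ M.E, T.encard + 3 ≤ p → M.Indep T) :
    PerFlat.Hall M p q (phiK p q) :=
  Shadow.hall_of_shadowHall (shadowHall_of_girth_pred p q hpq hg)

end GirthRows

end PercRepro
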